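import Literature.AlgebraicGeometry.Frobenioids.BirationalizationMorphisms
import Literature.AlgebraicGeometry.Frobenioids.CoAngular
import HarnessLib

/-!
# Frobenioids I, Proposition 4.4 (iv): co-angular pre-steps become isomorphisms, co-angular linear
morphisms become pull-back morphisms of `C^birat`

Mochizuki, *The geometry of Frobenioids I: the general theory*, Kyushu J. Math. **62** (2008)
293–400, §4, Proposition 4.4 (iv), kurims text p. 83 [cite: MochizukiFrdI2008, Prop. 4.4(iv) p.83]:
"A morphism of `C` maps to a(n) … isomorphism; …; pull-back morphism … of `C^birat` if [and only
if] it is a(n) … co-angular pre-step; …; co-angular linear morphism … of `C`."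

Over `BirationalizationMorphisms.lean`: (1) the image `ψ^birat` of a co-angular pre-step `ψ` is an
isomorphism of `C^birat`, with inverse the fraction `[(ψ, id)]`; (2) the image of a co-angular
LINEAR
morphism is a pull-back morphism of `C^birat` — factor `ψ = γ ≫ β ≫ α` (Def. 1.3 (iv)(a)); `γ`
(Frobenius type, here linear) and `β` (a pre-step, co-angular by Prop. 1.4 (iv),
`isCoAngular_iff_of_factorization`) become isomorphisms, `α` a pull-back morphism
(`isPullbackMorphism_toBirat_map`).  The "only if" directions are not treated here.
-/

namespace Literature.AlgebraicGeometry.Frobenioids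

open CategoryTheory Opposite

universe w v v' u u'

namespace PreFrobenioid

namespace Birat

variable {D : Type u} [Category.{v} D] {Φ : Dᵒᵖ ⥤ CommMonCat.{w}}
  {C : Type u'} [Category.{v'} C] {F : C ⥤ ElemFrobenioid Φ} {hF : IsFrobenioid F}
  {hsq : HasBiratSquares F}

/-- `ψ^birat ≫ [(ψ, id)] = id` for a co-angular pre-step `ψ`. [cite: MochizukiFrdI2008, Prop.
4.4(iv) p.83] -/
theorem toBirat_map_comp_invFrac {A A' : C} (ψ : A ⟶ A') (hψ : IsCoAngularPreStep F ψ) :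
    (toBirat F hF hsq).map ψ ≫
        homMk (X := (toBirat F hF hsq).obj A') (Y := (toBirat F hF hsq).obj A) ⟨A, ψ, 𝟙 A, hψ⟩ =
      𝟙 _ := by
  rw [toBirat_map]
  let S : BiratFrac.Square (BiratFrac.ofHom hF ψ) (⟨A, ψ, 𝟙 A, hψ⟩ : BiratFrac F A' A) :=
    { apex := A, left := 𝟙 A, right := 𝟙 A, left_mem := isCoAngularPreStep_id hF A, w := rfl }
  refine (homMk_comp_homMk_eq (X := (toBirat F hF hsq).obj A)
    (Y := (toBirat F hF hsq).obj A') (Z := (toBirat F hF hsq).obj A) _ _ S).trans ?_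
  rw [id_eq]
  apply homMk_sound
  refine ⟨A, 𝟙 A, 𝟙 A, isCoAngularPreStep_id hF A, isCoAngularPreStep_id hF A, ?_, ?_⟩
  · change 𝟙 A ≫ 𝟙 A ≫ 𝟙 A = 𝟙 A ≫ 𝟙 A
    rw [Category.id_comp]
  · change 𝟙 A ≫ 𝟙 A ≫ 𝟙 A = 𝟙 A ≫ 𝟙 A
    rw [Category.id_comp]

/-- `[(ψ, id)] ≫ ψ^birat = id` for a co-angular pre-step `ψ`. [cite: MochizukiFrdI2008, Prop.
4.4(iv) p.83] -/
theorem invFrac_comp_toBirat_map {A A' : C} (ψ : A ⟶ A') (hψ : IsCoAngularPreStep F ψ) :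
    homMk (X := (toBirat F hF hsq).obj A') (Y := (toBirat F hF hsq).obj A) ⟨A, ψ, 𝟙 A, hψ⟩ ≫
        (toBirat F hF hsq).map ψ = 𝟙 _ := by
  rw [toBirat_map]
  let S : BiratFrac.Square (⟨A, ψ, 𝟙 A, hψ⟩ : BiratFrac F A' A) (BiratFrac.ofHom hF ψ) :=
    { apex := A, left := 𝟙 A, right := 𝟙 A, left_mem := isCoAngularPreStep_id hF A, w := rfl }
  refine (homMk_comp_homMk_eq (X := (toBirat F hF hsq).obj A')
    (Y := (toBirat F hF hsq).obj A) (Z := (toBirat F hF hsq).obj A') _ _ S).trans ?_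
  rw [id_eq]
  apply homMk_sound
  refine ⟨A, 𝟙 A, ψ, isCoAngularPreStep_id hF A, hψ, ?_, ?_⟩
  · change 𝟙 A ≫ 𝟙 A ≫ ψ = ψ ≫ 𝟙 A'
    rw [Category.id_comp, Category.id_comp, Category.comp_id]
  · change 𝟙 A ≫ 𝟙 A ≫ ψ = ψ ≫ 𝟙 A'
    rw [Category.id_comp, Category.id_comp, Category.comp_id]

/-- **Prop. 4.4 (iv)**: a co-angular pre-step `ψ : A → A'` of `C` becomes an isomorphism of
`C^birat`
(inverse `[(ψ, id_A)] : A' ⇢ A`). [cite: MochizukiFrdI2008, Prop. 4.4(iv) p.83] -/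
theorem isIso_toBirat_map {A A' : C} (ψ : A ⟶ A') (hψ : IsCoAngularPreStep F ψ) :
    IsIso ((toBirat F hF hsq).map ψ) :=
  ⟨_, toBirat_map_comp_invFrac ψ hψ, invFrac_comp_toBirat_map ψ hψ⟩

/-- The inverse of `ψ^birat` for a co-angular pre-step `ψ` is the fraction `[(ψ, id)]`.
[cite: MochizukiFrdI2008, Prop. 4.4(iv) p.83] -/
theorem inv_toBirat_map {A A' : C} (ψ : A ⟶ A') (hψ : IsCoAngularPreStep F ψ) :
    haveI := isIso_toBirat_map (hF := hF) (hsq := hsq) ψ hψ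
    inv ((toBirat F hF hsq).map ψ) =
      homMk (X := (toBirat F hF hsq).obj A') (Y := (toBirat F hF hsq).obj A) ⟨A, ψ, 𝟙 A, hψ⟩ :=
  haveI := isIso_toBirat_map (hF := hF) (hsq := hsq) ψ hψ
  IsIso.inv_eq_of_hom_inv_id (toBirat_map_comp_invFrac ψ hψ)

/-- In a factorisation `ψ = γ ≫ β ≫ α` of a LINEAR `ψ` as in Def. 1.3 (iv)(a), the Frobenius-type
factor `γ` is linear, hence a co-angular pre-step. [cite: MochizukiFrdI2008, Def. 1.3(iv)] -/
theorem isCoAngularPreStep_of_factorisation (hF : IsFrobenioid F) {A A' X Y : C} {ψ : A ⟶ A'}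
    (hψ : IsLinear F ψ) {γ : A ⟶ X} {β : X ⟶ Y} {α : Y ⟶ A'} (hfac : γ ≫ β ≫ α = ψ)
    (hγ : IsFrobeniusType F γ) (hβ : IsPreStep F β) (hα : IsPullbackMorphism F α) :
    IsCoAngularPreStep F γ := by
  have hdeg := congrArg (degFr F) hfac
  rw [degFr_comp, degFr_comp, hβ.1, (hF.iv_b α hα).2, mul_one, mul_one] at hdeg
  have hlin : IsLinear F γ := by
    change degFr F γ = 1
    rw [hdeg]
    exact hψ
  exact ⟨hγ.1.1, hlin, hγ.2⟩

/-- **Prop. 4.4 (iv)**: a co-angular linear morphism of `C` becomes a pull-back morphism of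
`C^birat`
(factor it as pull-back ∘ pre-step ∘ Frobenius-type; the last two factors become isomorphisms).
[cite: MochizukiFrdI2008, Prop. 4.4(iv) p.83] -/
theorem isPullbackMorphism_toBirat_map_of_isCoAngular {A A' : C} {ψ : A ⟶ A'}
    (hco : IsCoAngular F ψ) (hlin : IsLinear F ψ) :
    IsPullbackMorphism (toElemGp hF hsq) ((toBirat F hF hsq).map ψ) := by
  obtain ⟨X, Y, γ, β, α, hfac, hγ, hβ, hα⟩ := hF.iv_a_exists ψ
  have hγc := isCoAngularPreStep_of_factorisation hF hlin hfac hγ hβ hα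
  have hβc : IsCoAngularPreStep F β :=
    ⟨(isCoAngular_iff_of_factorization F hF ψ γ β α hfac hγ hβ hα).mp hco, hβ⟩
  rw [← hfac, Functor.map_comp, Functor.map_comp]
  haveI := isIso_toBirat_map (hF := hF) (hsq := hsq) γ hγc
  haveI := isIso_toBirat_map (hF := hF) (hsq := hsq) β hβc
  exact IsPullbackMorphism.comp _ (isPullbackMorphism_of_isIso _ _)
    (IsPullbackMorphism.comp _ (isPullbackMorphism_of_isIso _ _)
      (isPullbackMorphism_toBirat_map hα))

/-- In particular every pull-back morphism and every co-angular pre-step of `C` becomes a pull-back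
morphism of `C^birat`; so does every linear morphism of a Frobenioid of isotropic type.
[cite: MochizukiFrdI2008, Prop. 4.4(iv) p.83] -/
theorem isPullbackMorphism_toBirat_map_of_isotropic (hiso : IsOfIsotropicType F) {A A' : C}
    {ψ : A ⟶ A'} (hlin : IsLinear F ψ) :
    IsPullbackMorphism (toElemGp hF hsq) ((toBirat F hF hsq).map ψ) :=
  isPullbackMorphism_toBirat_map_of_isCoAngular
    (isCoAngular_of_isIsotropic_codomains F ψ fun X _ => hiso X) hlin

end Birat

end PreFrobenioid

end Literature.AlgebraicGeometry.Frobenioids
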